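import Literature.Analysis.FluidPDE.NSLerayHopfABCEigenmode
import Literature.Analysis.FluidPDE.LerayHopfMild
import Literature.Analysis.FluidPDE.TaoEnstrophyLocalisationProofs
import HarnessLib

/-!
# Albritton–Brué–Colombo 2022: the energy identity of the linearised similarity operator and the
  a-priori bound `Re λ ≤ sup(−sym ∇Ū) − ¼` for its eigenvalues

Analysis/FluidPDE proofs-layer file (theorems only, no definitions, no named facts) on the proof
line of the named fact `Literature.Analysis.FluidPDE.albritton_brue_colombo_unit`
(`NSLerayHopfABCScaling.lean`; Albritton–Brué–Colombo, Ann. of Math. 196 (2022) = arXiv:2112.03116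
[ABC], Thm. 1.2). The tree reduces that fact to an UNSTABLE (or neutral) EIGENMODE of the
linearised similarity operator `L_ss` of [ABC] (1.10) at a smooth profile `Ū`
(`albritton_brue_colombo_unit_of_unstableMode`, `NSLerayHopfABCEigenmode.lean`): smooth
divergence-free `η₁, η₂`, pressures `q₁, q₂` and `λ = a + ib` with
`aη₁ − bη₂ + N_Ū(η₁) + ∇q₁ = 0`, `bη₁ + aη₂ + N_Ū(η₂) + ∇q₂ = 0`,
`N_Ū(η) = −½(η + Dη·ξ) − Δη + Ū·∇η + η·∇Ū` (`steadyLinearizedResidual`).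

This file proves the **energy identity** behind the "energy estimate" that [ABC] §4.1 (after
Lemma 4.2, citing Jia–Šverák, *J. Funct. Anal.* 268 (2015)) use to place the essential spectrum of
`L_ss` in `{Re λ ≤ −¼}`: pairing the two equations with `η₁`, `η₂` in `L²(E)` (`E` a
finite-dimensional real inner product space of dimension `n`; `n = 3` in [ABC]) and integrating by
parts on the whole space,

  `(a + n/4 − ½)(‖η₁‖² + ‖η₂‖²) + (‖∇η₁‖² + ‖∇η₂‖²) + ∫⟪η₁, DŪ η₁⟫ + ∫⟪η₂, DŪ η₂⟫ = 0`

(`energy_identity_of_unstableMode`), because `∫⟪η, Dη·ξ⟫ = −(n/2)‖η‖²`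
(`integral_inner_fderiv_apply_self_eq`), `∫⟪η, Δη⟫ = −‖∇η‖²`
(`integral_inner_laplacian_self_eq`), `∫⟪η, (Ū·∇)η⟫ = 0` for divergence-free `Ū`
(`integral_inner_fderiv_apply_of_isDivFree_eq_zero`) and `∫⟪η, ∇q⟫ = 0` for divergence-free
`η` (`integral_inner_gradient_eq_zero_of_isDivFree`), while the `b`-terms cancel. Consequently
(`re_eigenvalue_le_of_unstableMode`, `re_eigenvalue_le_of_unstableMode_fin3`): **if
`⟪w, DŪ(ξ) w⟫ ≥ −M‖w‖²` for all `ξ, w` (the symmetric part of `∇Ū` is bounded below by `−M`),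
every such eigenmode with `η₁ ≢ 0` has `a ≤ M + ½ − n/4`, i.e. `Re λ ≤ M − ¼` on `ℝ³`.** In
particular no profile whose strain is everywhere smaller than `¼` (e.g. a small or slowly varying
`Ū`) can carry the unstable mode required by [ABC] Thm. 1.3 (a) — the quantitative form of the
remark that the instability is an `O(1)` effect of `Ū` (in [ABC], `Ū = βŪ₀` with `β ≫ 1`, §3).
The last section states the bound for the operator (1.10) **verbatim** (`negLss`, classical Leray
projection, `Ū ∈ C_c^∞`; `re_eigenvalue_le_of_eigenmode`): the pressure `q = −π[B(Ū, η)]` and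
its first derivatives `∂ᵥq = −π[∂ᵥB(Ū, η)]` (`fderiv_divPotential_apply`) are Newtonian
potentials of divergences of test fields, hence in `L²` (`memLp_divPotential`,
`memLp_fderiv_divPotential_apply`).

Hypotheses are INTEGRABILITY hypotheses (`L²` membership of `η`, `∂ᵢη`, `∂ᵢ∂ᵢη`, `ξᵢη`, `ξᵢ∂ᵢη`,
`q`, `∂ᵢq` in the standard orthonormal frame), not compact support or a decay rate: velocity
eigenfunctions of `L_ss` may decay only like `|ξ|⁻³` (the far field of a divergence-free field with
rapidly decaying curl is a harmonic dipole), a rate the tree's polynomial-decay identities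
(`EnergyUniqueness.lean`, rate `r > n + 1`) do not cover. All four
integrations by parts are instances of the tree's
`HasWeakGradient.integral_inner_fderiv_apply_of_memLp` (`LerayHopfMild.lean`) with the classical
derivative as weak gradient (`hasWeakGradient_fderiv_of_contDiff`).

## References

* D. Albritton, E. Brué, M. Colombo, *Non-uniqueness of Leray solutions of the forced Navier–Stokes
  equations*, Ann. of Math. (2) 196 (2022) 415–455, arXiv:2112.03116: (1.10); §4.1, Lemma 4.2 and
  the paragraph after Prop. 4.3 ("whose essential spectrum is contained in `{Re λ ≤ −1/4}`, as is
  easily demonstrated by an energy estimate"). [AlbrittonBrueColombo2022AnnMath]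
* H. Jia, V. Šverák, *Are the incompressible 3d Navier–Stokes equations locally ill-posed in the
  natural energy space?*, J. Funct. Anal. 268 (2015) 3734–3766 = arXiv:1306.2136, §2, Lemma 2.1
  (`ρ(𝓛) ⊇ {Re λ > −¼}` for `𝓛 = Δ + ½x·∇ + ½` on `L²`, by the energy method) and the relative
  compactness of `φ ↦ U_σ·∇φ + φ·∇U_σ + ∇P` (§1, before Thm. 1.1). [JiaSverak2015]
-/

noncomputable section

open MeasureTheory TopologicalSpace Set Function Filter Topology InnerProductSpace Module
open scoped RealInnerProductSpace NNReal ENNReal Laplacian ContDiff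

namespace Literature.Analysis.FluidPDE

namespace AlbrittonBrueColombo2022

variable {E : Type*} [NormedAddCommGroup E] [InnerProductSpace ℝ E] [FiniteDimensional ℝ E]
  [MeasurableSpace E] [BorelSpace E]

/-! ### Frame expansions -/

omit [MeasurableSpace E] [BorelSpace E] in
/-- Expansion of a linear map along the standard orthonormal frame:
`L w = Σᵢ ⟪eᵢ, w⟫ L eᵢ`. [folklore] -/
theorem clm_apply_eq_sum_inner_smul {F : Type*} [NormedAddCommGroup F] [NormedSpace ℝ F]
    (L : E →L[ℝ] F) (w : E) :
    L w = ∑ i, ⟪stdOrthonormalBasis ℝ E i, w⟫ • L (stdOrthonormalBasis ℝ E i) := by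
  conv_lhs => rw [← (stdOrthonormalBasis ℝ E).sum_repr' w]
  simp [map_sum, map_smul]

omit [MeasurableSpace E] [BorelSpace E] in
/-- `⟪η, Dη(ξ) w⟫ = Σᵢ ⟪eᵢ, w⟫ ⟪η, ∂ᵢη⟫` (frame expansion of a directional derivative). [folklore] -/
theorem inner_fderiv_apply_eq_sum {F : Type*} [NormedAddCommGroup F] [InnerProductSpace ℝ F]
    (η : E → F) (ξ w : E) (c : F) :
    ⟪c, fderiv ℝ η ξ w⟫ =
      ∑ i, ⟪stdOrthonormalBasis ℝ E i, w⟫ * ⟪c, fderiv ℝ η ξ (stdOrthonormalBasis ℝ E i)⟫ := by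
  rw [clm_apply_eq_sum_inner_smul (fderiv ℝ η ξ) w, inner_sum]
  exact Finset.sum_congr rfl fun i _ => by rw [real_inner_smul_right]

omit [FiniteDimensional ℝ E] [MeasurableSpace E] [BorelSpace E] in
/-- The coordinate function `ξ ↦ ⟪eᵢ, ξ⟫` is smooth with derivative `v ↦ ⟪eᵢ, v⟫`. [folklore] -/
theorem fderiv_inner_const_left_id (c x v : E) :
    fderiv ℝ (fun y : E => ⟪c, y⟫) x v = ⟪c, v⟫ := by
  change fderiv ℝ (innerSL ℝ c) x v = _
  rw [(innerSL ℝ c).fderiv]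
  rfl

/-! ### `∫ ⟪η, Dη·ξ⟫ = −(n/2) ‖η‖²` -/

/-- **The similarity drift is `L²`-dissipative with constant `n/2`:**
`∫ ⟪η, Dη(ξ)ξ⟫ dξ = −(n/2) ∫ ‖η‖²` for a smooth `η : E → F` with `η, ∂ᵢη, ξᵢη, ξᵢ∂ᵢη ∈ L²`
(`n = dim E`). Proof: for each frame vector `eᵢ`, integrating `⟪η, ∂ᵢ(ξᵢη)⟫ = ‖η‖² + ξᵢ⟪η, ∂ᵢη⟫`
by parts against `∂ᵢη` gives `2∫ ξᵢ⟪η, ∂ᵢη⟫ = −∫‖η‖²`; sum over `i`. This is the integration by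
parts behind `⟨(ξ·∇)U, U⟩ = −(3/2)‖U‖²` in the energy estimate for `L_ss` ([ABC] §4.1;
Jia–Šverák 2015, §2). [cite: AlbrittonBrueColombo2022AnnMath, §4.1 (energy estimate after Prop. 4.3)] -/
theorem integral_inner_fderiv_apply_self_eq {F : Type*} [NormedAddCommGroup F]
    [InnerProductSpace ℝ F] [FiniteDimensional ℝ F] {η : E → F} (hη : ContDiff ℝ ∞ η)
    (h0 : MemLp η 2 volume)
    (h1 : ∀ i, MemLp (fun x => fderiv ℝ η x (stdOrthonormalBasis ℝ E i)) 2 volume)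
    (hw0 : ∀ i, MemLp (fun x => ⟪stdOrthonormalBasis ℝ E i, x⟫ • η x) 2 volume)
    (hw1 : ∀ i, MemLp (fun x => ⟪stdOrthonormalBasis ℝ E i, x⟫ •
      fderiv ℝ η x (stdOrthonormalBasis ℝ E i)) 2 volume) :
    ∫ x, ⟪η x, fderiv ℝ η x x⟫ = -((Module.finrank ℝ E : ℝ) / 2) * ∫ x, ‖η x‖ ^ 2 := by
  set b := stdOrthonormalBasis ℝ E with hb
  have hη1 : ContDiff ℝ 1 η := hη.of_le (by norm_cast)
  have hηd : Differentiable ℝ η := hη.differentiable (by simp)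
  -- integrability of the pieces
  have hA : Integrable (fun x => ‖η x‖ ^ 2) volume := (memLp_two_iff_integrable_sq_norm h0.1).1 h0
  have hC : ∀ i, Integrable (fun x => ⟪b i, x⟫ * ⟪η x, fderiv ℝ η x (b i)⟫) volume := by
    intro i
    have h := integrable_inner_of_memLp_two (hw0 i) (h1 i)
    refine h.congr (Eventually.of_forall fun x => ?_)
    simp only [real_inner_smul_left]
  -- the coordinate identity `∫ ξᵢ ⟪η, ∂ᵢη⟫ = −½ ∫ ‖η‖²`
  have hcoord : ∀ i, ∫ x, ⟪b i, x⟫ * ⟪η x, fderiv ℝ η x (b i)⟫ = -(1 / 2) * ∫ x, ‖η x‖ ^ 2 := by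
    intro i
    set W : E → F := fun x => ⟪b i, x⟫ • η x with hW
    have hc : ContDiff ℝ ∞ (fun x : E => ⟪b i, x⟫) := contDiff_const.inner ℝ contDiff_id
    have hWs : ContDiff ℝ ∞ W := hc.smul hη
    have hDW : ∀ x, fderiv ℝ W x (b i) = η x + ⟪b i, x⟫ • fderiv ℝ η x (b i) := by
      intro x
      have hcd : DifferentiableAt ℝ (fun y : E => ⟪b i, y⟫) x := (hc.differentiable (by simp)) x
      rw [hW, fderiv_fun_smul hcd (hηd x)]
      simp only [add_apply, FunLike.coe_smul, Pi.smul_apply,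
        ContinuousLinearMap.smulRight_apply, fderiv_inner_const_left_id]
      have h11 : ⟪b i, b i⟫ = (1 : ℝ) := by
        rw [real_inner_self_eq_norm_sq, b.orthonormal.1 i, one_pow]
      rw [h11, one_smul, add_comm]
    have hDWmem : MemLp (fun x => fderiv ℝ W x (b i)) 2 volume := by
      have : (fun x => fderiv ℝ W x (b i)) = fun x => η x + ⟪b i, x⟫ • fderiv ℝ η x (b i) :=
        funext hDW
      rw [this]
      exact h0.add (hw1 i)
    have hibp := (hasWeakGradient_fderiv_of_contDiff hη1).integral_inner_fderiv_apply_of_memLp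
      h0 (b i) (h1 i) hWs (hw0 i) hDWmem
    -- expand both sides
    have hL : ∫ x, ⟪η x, fderiv ℝ W x (b i)⟫ =
        (∫ x, ‖η x‖ ^ 2) + ∫ x, ⟪b i, x⟫ * ⟪η x, fderiv ℝ η x (b i)⟫ := by
      rw [← integral_add hA (hC i)]
      refine integral_congr_ae (Eventually.of_forall fun x => ?_)
      simp only [hDW, inner_add_right, real_inner_smul_right, real_inner_self_eq_norm_sq]
    have hR : ∫ x, ⟪fderiv ℝ η x (b i), W x⟫ = ∫ x, ⟪b i, x⟫ * ⟪η x, fderiv ℝ η x (b i)⟫ := by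
      refine integral_congr_ae (Eventually.of_forall fun x => ?_)
      simp only [hW, real_inner_smul_right, real_inner_comm]
    rw [hL, hR] at hibp
    linarith
  -- sum over the frame
  have hpt : ∀ x, ⟪η x, fderiv ℝ η x x⟫ = ∑ i, ⟪b i, x⟫ * ⟪η x, fderiv ℝ η x (b i)⟫ := fun x =>
    inner_fderiv_apply_eq_sum η x x (η x)
  simp_rw [hpt]
  rw [integral_finsetSum _ fun i _ => hC i, Finset.sum_congr rfl fun i _ => hcoord i,
    Finset.sum_const, Finset.card_univ, Fintype.card_fin, nsmul_eq_mul]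
  ring

/-! ### `∫ ⟪η, (Ū·∇)η⟫ = 0` for divergence-free `Ū` -/

/-- **The transport term is `L²`-skew:** `∫ ⟪η, Dη(ξ)(Ū ξ)⟫ dξ = 0` for a smooth `η : E → F`
with `η, ∂ᵢη ∈ L²` and a smooth divergence-free drift `Ū` which is bounded with bounded
derivative. Proof: for each frame vector `eᵢ`, integrating `⟪η, ∂ᵢ(Ūᵢη)⟫ = (∂ᵢŪᵢ)‖η‖² + Ūᵢ⟪η, ∂ᵢη⟫`
by parts against `∂ᵢη` gives `2∫ Ūᵢ⟪η, ∂ᵢη⟫ = −∫ (∂ᵢŪᵢ)‖η‖²`; summing over `i` the right-hand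
side is `−∫ (div Ū)‖η‖² = 0` ([ABC] §4.1 energy estimate: `⟨Ū·∇U, U⟩ = 0`; Majda–Bertozzi
§3.1.1). [cite: AlbrittonBrueColombo2022AnnMath, §4.1 (energy estimate after Prop. 4.3)] -/
theorem integral_inner_fderiv_apply_of_isDivFree_eq_zero {F : Type*} [NormedAddCommGroup F]
    [InnerProductSpace ℝ F] [FiniteDimensional ℝ F] {η : E → F} (hη : ContDiff ℝ ∞ η)
    (h0 : MemLp η 2 volume)
    (h1 : ∀ i, MemLp (fun x => fderiv ℝ η x (stdOrthonormalBasis ℝ E i)) 2 volume)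
    {Ubar : E → E} (hU : ContDiff ℝ ∞ Ubar) (hUdiv : VectorCalculus.IsDivFree Ubar) {M₀ M₁ : ℝ}
    (hM₀ : ∀ x, ‖Ubar x‖ ≤ M₀) (hM₁ : ∀ x, ‖fderiv ℝ Ubar x‖ ≤ M₁) :
    ∫ x, ⟪η x, fderiv ℝ η x (Ubar x)⟫ = 0 := by
  set b := stdOrthonormalBasis ℝ E with hb
  have hη1 : ContDiff ℝ 1 η := hη.of_le (by norm_cast)
  have hηd : Differentiable ℝ η := hη.differentiable (by simp)
  have hUd : Differentiable ℝ Ubar := hU.differentiable (by simp)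
  have hηc : Continuous η := hη.continuous
  have hUc : Continuous Ubar := hU.continuous
  have hDUc : Continuous (fderiv ℝ Ubar) := hU.continuous_fderiv (by simp)
  have hDηc : ∀ i, Continuous fun x => fderiv ℝ η x (b i) := fun i =>
    (hη.continuous_fderiv (by simp)).clm_apply continuous_const
  have hM₀0 : 0 ≤ M₀ := (norm_nonneg _).trans (hM₀ 0)
  -- integrability of the pieces
  have hA : Integrable (fun x => ‖η x‖ ^ 2) volume := (memLp_two_iff_integrable_sq_norm h0.1).1 h0
  -- `Ūᵢ η ∈ L²`
  have hUη : ∀ i, MemLp (fun x => ⟪b i, Ubar x⟫ • η x) 2 volume := by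
    intro i
    refine h0.of_le_mul (c := M₀) ((continuous_const.inner hUc).smul hηc).aestronglyMeasurable
      (Eventually.of_forall fun x => ?_)
    rw [norm_smul]
    exact mul_le_mul_of_nonneg_right
      ((abs_real_inner_le_norm _ _).trans (by rw [b.orthonormal.1 i, one_mul]; exact hM₀ x))
      (norm_nonneg _)
  have hD : ∀ i, Integrable (fun x => ⟪b i, Ubar x⟫ * ⟪η x, fderiv ℝ η x (b i)⟫) volume := by
    intro i
    have h := integrable_inner_of_memLp_two (hUη i) (h1 i)
    refine h.congr (Eventually.of_forall fun x => ?_)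
    simp only [real_inner_smul_left]
  have hDUb : ∀ i x, ‖⟪b i, fderiv ℝ Ubar x (b i)⟫‖ ≤ M₁ := by
    intro i x
    have hbi : ‖b i‖ = 1 := b.orthonormal.1 i
    calc ‖⟪b i, fderiv ℝ Ubar x (b i)⟫‖ ≤ ‖b i‖ * ‖fderiv ℝ Ubar x (b i)‖ := norm_inner_le_norm _ _
      _ ≤ ‖b i‖ * (‖fderiv ℝ Ubar x‖ * ‖b i‖) :=
          mul_le_mul_of_nonneg_left (ContinuousLinearMap.le_opNorm _ _) (norm_nonneg _)
      _ = ‖fderiv ℝ Ubar x‖ := by rw [hbi, one_mul, mul_one]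
      _ ≤ M₁ := hM₁ x
  have hB : ∀ i, Integrable (fun x => ⟪b i, fderiv ℝ Ubar x (b i)⟫ * ‖η x‖ ^ 2) volume := by
    intro i
    refine (hA.const_mul M₁).mono'
      (((continuous_const.inner (hDUc.clm_apply continuous_const)).mul (hηc.norm.pow 2))
        |>.aestronglyMeasurable) (Eventually.of_forall fun x => ?_)
    rw [norm_mul, norm_pow, norm_norm]
    exact mul_le_mul_of_nonneg_right (hDUb i x) (by positivity)
  -- the coordinate identity `2 ∫ Ūᵢ ⟪η, ∂ᵢη⟫ = −∫ (∂ᵢŪᵢ) ‖η‖²`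
  have hcoord : ∀ i, 2 * ∫ x, ⟪b i, Ubar x⟫ * ⟪η x, fderiv ℝ η x (b i)⟫ =
      -∫ x, ⟪b i, fderiv ℝ Ubar x (b i)⟫ * ‖η x‖ ^ 2 := by
    intro i
    set W : E → F := fun x => ⟪b i, Ubar x⟫ • η x with hW
    have hc : ContDiff ℝ ∞ (fun x : E => ⟪b i, Ubar x⟫) := contDiff_const.inner ℝ hU
    have hWs : ContDiff ℝ ∞ W := hc.smul hη
    have hDW : ∀ x, fderiv ℝ W x (b i) =
        ⟪b i, fderiv ℝ Ubar x (b i)⟫ • η x + ⟪b i, Ubar x⟫ • fderiv ℝ η x (b i) := by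
      intro x
      have hcd : DifferentiableAt ℝ (fun y : E => ⟪b i, Ubar y⟫) x :=
        (hc.differentiable (by simp)) x
      rw [hW, fderiv_fun_smul hcd (hηd x)]
      simp only [add_apply, FunLike.coe_smul, Pi.smul_apply,
        ContinuousLinearMap.smulRight_apply, fderiv_inner_const_left_apply hUd]
      rw [add_comm]
    have hDWmem : MemLp (fun x => fderiv ℝ W x (b i)) 2 volume := by
      have : (fun x => fderiv ℝ W x (b i)) = fun x =>
          ⟪b i, fderiv ℝ Ubar x (b i)⟫ • η x + ⟪b i, Ubar x⟫ • fderiv ℝ η x (b i) := funext hDW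
      rw [this]
      refine MemLp.add ?_ ?_
      · refine h0.of_le_mul (c := M₁)
          ((continuous_const.inner (hDUc.clm_apply continuous_const)).smul hηc).aestronglyMeasurable
          (Eventually.of_forall fun x => ?_)
        rw [norm_smul]
        exact mul_le_mul_of_nonneg_right (hDUb i x) (norm_nonneg _)
      · refine (h1 i).of_le_mul (c := M₀)
          ((continuous_const.inner hUc).smul (hDηc i)).aestronglyMeasurable
          (Eventually.of_forall fun x => ?_)
        rw [norm_smul]
        exact mul_le_mul_of_nonneg_right
          ((abs_real_inner_le_norm _ _).trans (by rw [b.orthonormal.1 i, one_mul]; exact hM₀ x))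
          (norm_nonneg _)
    have hibp := (hasWeakGradient_fderiv_of_contDiff hη1).integral_inner_fderiv_apply_of_memLp
      h0 (b i) (h1 i) hWs (hUη i) hDWmem
    have hL : ∫ x, ⟪η x, fderiv ℝ W x (b i)⟫ =
        (∫ x, ⟪b i, fderiv ℝ Ubar x (b i)⟫ * ‖η x‖ ^ 2) +
          ∫ x, ⟪b i, Ubar x⟫ * ⟪η x, fderiv ℝ η x (b i)⟫ := by
      rw [← integral_add (hB i) (hD i)]
      refine integral_congr_ae (Eventually.of_forall fun x => ?_)
      simp only [hDW, inner_add_right, real_inner_smul_right, real_inner_self_eq_norm_sq]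
    have hR : ∫ x, ⟪fderiv ℝ η x (b i), W x⟫ = ∫ x, ⟪b i, Ubar x⟫ * ⟪η x, fderiv ℝ η x (b i)⟫ := by
      refine integral_congr_ae (Eventually.of_forall fun x => ?_)
      simp only [hW, real_inner_smul_right, real_inner_comm]
    rw [hL, hR] at hibp
    linarith
  -- sum over the frame: `2 ∫ ⟪η, Dη Ū⟫ = −∫ (div Ū) ‖η‖² = 0`
  have hpt : ∀ x, ⟪η x, fderiv ℝ η x (Ubar x)⟫ = ∑ i, ⟪b i, Ubar x⟫ * ⟪η x, fderiv ℝ η x (b i)⟫ :=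
    fun x => inner_fderiv_apply_eq_sum η x (Ubar x) (η x)
  have hsum : 2 * ∫ x, ⟪η x, fderiv ℝ η x (Ubar x)⟫ =
      -∫ x, VectorCalculus.divergence Ubar x * ‖η x‖ ^ 2 := by
    simp_rw [hpt]
    rw [integral_finsetSum _ fun i _ => hD i, Finset.mul_sum,
      Finset.sum_congr rfl fun i _ => hcoord i, Finset.sum_neg_distrib,
      ← integral_finsetSum _ fun i _ => hB i]
    congr 1
    refine integral_congr_ae (Eventually.of_forall fun x => ?_)
    simp only [divergence_eq_sum_inner_fderiv b Ubar x, Finset.sum_mul]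
  have h0' : ∫ x, VectorCalculus.divergence Ubar x * ‖η x‖ ^ 2 = 0 := by
    simp [hUdiv _]
  rw [h0', neg_zero] at hsum
  linarith

/-! ### `∫ ⟪η, ∇q⟫ = 0` for divergence-free `η` -/

/-- **Divergence-free fields are `L²`-orthogonal to gradients, beyond compact support:**
`∫ ⟪η, ∇q⟫ = 0` for a smooth divergence-free `η : E → E` with `η, ∂ᵢη ∈ L²` and a smooth `q`
with `q, ∂ᵢq ∈ L²`. Proof: `∫ q ∂ᵢηᵢ = −∫ (∂ᵢq) ηᵢ` coordinatewise (weak-gradient identity for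
the scalar `q`), summed: `∫ q div η = −∫ Dq(η) = −∫⟪∇q, η⟫`, and `div η = 0` ([ABC] §4.1:
the pressure drops out of the energy estimate; Majda–Bertozzi §3.1.1, pressure term).
[cite: AlbrittonBrueColombo2022AnnMath, §4.1 (energy estimate after Prop. 4.3)] -/
theorem integral_inner_gradient_eq_zero_of_isDivFree {η : E → E} (hη : ContDiff ℝ ∞ η)
    (hdiv : VectorCalculus.IsDivFree η) (h0 : MemLp η 2 volume)
    (h1 : ∀ i, MemLp (fun x => fderiv ℝ η x (stdOrthonormalBasis ℝ E i)) 2 volume)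
    {q : E → ℝ} (hq : ContDiff ℝ ∞ q) (hq0 : MemLp q 2 volume)
    (hq1 : ∀ i, MemLp (fun x => fderiv ℝ q x (stdOrthonormalBasis ℝ E i)) 2 volume) :
    ∫ x, ⟪η x, gradient q x⟫ = 0 := by
  set b := stdOrthonormalBasis ℝ E with hb
  have hq1' : ContDiff ℝ 1 q := hq.of_le (by norm_cast)
  have hηd : Differentiable ℝ η := hη.differentiable (by simp)
  have hηc : Continuous η := hη.continuous
  have hDηc : ∀ i, Continuous fun x => fderiv ℝ η x (b i) := fun i =>
    (hη.continuous_fderiv (by simp)).clm_apply continuous_const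
  -- components of `η` and their derivatives are in `L²`
  have hηi : ∀ i, MemLp (fun x => ⟪b i, η x⟫) 2 volume := by
    intro i
    refine h0.of_le_mul (c := 1) (continuous_const.inner hηc).aestronglyMeasurable
      (Eventually.of_forall fun x => ?_)
    calc ‖⟪b i, η x⟫‖ ≤ ‖b i‖ * ‖η x‖ := norm_inner_le_norm _ _
      _ = 1 * ‖η x‖ := by rw [b.orthonormal.1 i]
  have hDηi : ∀ i, MemLp (fun x => fderiv ℝ (fun y => ⟪b i, η y⟫) x (b i)) 2 volume := by
    intro i
    have : (fun x => fderiv ℝ (fun y => ⟪b i, η y⟫) x (b i)) = fun x => ⟪b i, fderiv ℝ η x (b i)⟫ :=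
      funext fun x => fderiv_inner_const_left_apply hηd (b i) x (b i)
    rw [this]
    refine (h1 i).of_le_mul (c := 1) (continuous_const.inner (hDηc i)).aestronglyMeasurable
      (Eventually.of_forall fun x => ?_)
    calc ‖⟪b i, fderiv ℝ η x (b i)⟫‖ ≤ ‖b i‖ * ‖fderiv ℝ η x (b i)‖ := norm_inner_le_norm _ _
      _ = 1 * ‖fderiv ℝ η x (b i)‖ := by rw [b.orthonormal.1 i]
  -- integrability of the products
  have hP : ∀ i, Integrable (fun x => q x * ⟪b i, fderiv ℝ η x (b i)⟫) volume := by
    intro i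
    have h := integrable_inner_of_memLp_two hq0 (hDηi i)
    refine h.congr (Eventually.of_forall fun x => ?_)
    simp only [fderiv_inner_const_left_apply hηd, RCLike.inner_apply, conj_trivial, mul_comm]
  have hQ : ∀ i, Integrable (fun x => fderiv ℝ q x (b i) * ⟪b i, η x⟫) volume := by
    intro i
    have h := integrable_inner_of_memLp_two (hq1 i) (hηi i)
    refine h.congr (Eventually.of_forall fun x => ?_)
    simp only [RCLike.inner_apply, conj_trivial, mul_comm]
  -- coordinate identity `∫ q ∂ᵢηᵢ = −∫ (∂ᵢq) ηᵢ`
  have hcoord : ∀ i, ∫ x, q x * ⟪b i, fderiv ℝ η x (b i)⟫ = -∫ x, fderiv ℝ q x (b i) * ⟪b i, η x⟫ := by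
    intro i
    have hWs : ContDiff ℝ ∞ (fun y => ⟪b i, η y⟫) := contDiff_const.inner ℝ hη
    have hibp := (hasWeakGradient_fderiv_of_contDiff (F' := ℝ) hq1').integral_inner_fderiv_apply_of_memLp
      hq0 (b i) (hq1 i) hWs (hηi i) (hDηi i)
    have hL : ∫ x, ⟪q x, fderiv ℝ (fun y => ⟪b i, η y⟫) x (b i)⟫ =
        ∫ x, q x * ⟪b i, fderiv ℝ η x (b i)⟫ := by
      refine integral_congr_ae (Eventually.of_forall fun x => ?_)
      simp only [fderiv_inner_const_left_apply hηd, RCLike.inner_apply, conj_trivial, mul_comm]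
    have hR : ∫ x, ⟪fderiv ℝ q x (b i), ⟪b i, η x⟫⟫ = ∫ x, fderiv ℝ q x (b i) * ⟪b i, η x⟫ := by
      refine integral_congr_ae (Eventually.of_forall fun x => ?_)
      simp only [RCLike.inner_apply, conj_trivial, mul_comm]
    rw [hL, hR] at hibp
    exact hibp
  -- sum over the frame
  have hgrad : ∀ x, ⟪η x, gradient q x⟫ = ∑ i, fderiv ℝ q x (b i) * ⟪b i, η x⟫ := by
    intro x
    rw [inner_gradient_eq_fderiv_apply, clm_apply_eq_sum_inner_smul (fderiv ℝ q x) (η x)]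
    exact Finset.sum_congr rfl fun i _ => by rw [smul_eq_mul, mul_comm]
  have hdivq : ∀ x, ∑ i, q x * ⟪b i, fderiv ℝ η x (b i)⟫ = 0 := fun x => by
    rw [← Finset.mul_sum, ← divergence_eq_sum_inner_fderiv b η x, hdiv x, mul_zero]
  calc ∫ x, ⟪η x, gradient q x⟫ = ∫ x, ∑ i, fderiv ℝ q x (b i) * ⟪b i, η x⟫ := by simp_rw [hgrad]
    _ = ∑ i, ∫ x, fderiv ℝ q x (b i) * ⟪b i, η x⟫ := integral_finsetSum _ fun i _ => hQ i
    _ = -∑ i, ∫ x, q x * ⟪b i, fderiv ℝ η x (b i)⟫ := by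
        rw [Finset.sum_congr rfl fun i _ => hcoord i, Finset.sum_neg_distrib, neg_neg]
    _ = -∫ x, ∑ i, q x * ⟪b i, fderiv ℝ η x (b i)⟫ := by
        rw [integral_finsetSum _ fun i _ => hP i]
    _ = 0 := by simp_rw [hdivq, integral_zero, neg_zero]

/-! ### `∫ ⟪η, Δη⟫ = −‖∇η‖²` -/

/-- **Green's identity beyond compact support:** `∫ ⟪η, Δη⟫ = −∫ |∇η|²` for a smooth `η : E → F`
with `η, ∂ᵢη, ∂ᵢ∂ᵢη ∈ L²`, where `|∇η|² = Σᵢ ‖∂ᵢη‖²` is the Frobenius norm `frobeniusNormSq (Dη)`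
(the tree's `HasWeakGradient.integral_inner_laplacian_of_memLp` with the classical derivative as
weak gradient; [ABC] §4.1: `⟨ΔU, U⟩ = −‖∇U‖²`). [cite: AlbrittonBrueColombo2022AnnMath, §4.1 (energy estimate after Prop. 4.3)] -/
theorem integral_inner_laplacian_self_eq {η : E → E} (hη : ContDiff ℝ ∞ η) (h0 : MemLp η 2 volume)
    (h1 : ∀ i, MemLp (fun x => fderiv ℝ η x (stdOrthonormalBasis ℝ E i)) 2 volume)
    (h2 : ∀ i, MemLp (fun x => fderiv ℝ (fun y => fderiv ℝ η y (stdOrthonormalBasis ℝ E i)) x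
      (stdOrthonormalBasis ℝ E i)) 2 volume) :
    ∫ x, ⟪η x, (Δ η) x⟫ = -∫ x, frobeniusNormSq (fderiv ℝ η x) := by
  set b := stdOrthonormalBasis ℝ E with hb
  have hη1 : ContDiff ℝ 1 η := hη.of_le (by norm_cast)
  have h := (hasWeakGradient_fderiv_of_contDiff hη1).integral_inner_laplacian_of_memLp h0 h1 hη h1 h2
  rw [h]
  have hsq : ∀ i, Integrable (fun x => ‖fderiv ℝ η x (b i)‖ ^ 2) volume := fun i =>
    (memLp_two_iff_integrable_sq_norm (h1 i).1).1 (h1 i)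
  simp_rw [frobeniusNormSq_eq_sum b]
  rw [integral_finsetSum _ fun i _ => hsq i]
  congr 1
  refine Finset.sum_congr rfl fun i _ => integral_congr_ae (Eventually.of_forall fun x => ?_)
  simp only [real_inner_self_eq_norm_sq, hb]


/-! ### Integrability of the energy densities -/

section Integrability

variable {η : E → E} {Ubar : E → E} {q : E → ℝ}

/-- `⟪η, Dη·ξ⟫ ∈ L¹` when `ξᵢη, ∂ᵢη ∈ L²`. [folklore] -/
theorem integrable_inner_fderiv_apply_self
    (h1 : ∀ i, MemLp (fun x => fderiv ℝ η x (stdOrthonormalBasis ℝ E i)) 2 volume)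
    (hw0 : ∀ i, MemLp (fun x => ⟪stdOrthonormalBasis ℝ E i, x⟫ • η x) 2 volume) :
    Integrable (fun x => ⟪η x, fderiv ℝ η x x⟫) volume := by
  have hC : ∀ i, Integrable (fun x => ⟪stdOrthonormalBasis ℝ E i, x⟫ *
      ⟪η x, fderiv ℝ η x (stdOrthonormalBasis ℝ E i)⟫) volume := fun i =>
    (integrable_inner_of_memLp_two (hw0 i) (h1 i)).congr
      (Eventually.of_forall fun x => by simp only [real_inner_smul_left])
  refine (integrable_finsetSum Finset.univ fun i _ => hC i).congr
    (Eventually.of_forall fun x => ?_)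
  exact (inner_fderiv_apply_eq_sum η x x (η x)).symm

/-- `⟪η, Δη⟫ ∈ L¹` when `η, ∂ᵢ∂ᵢη ∈ L²`. [folklore] -/
theorem integrable_inner_laplacian_self (hη : ContDiff ℝ ∞ η) (h0 : MemLp η 2 volume)
    (h2 : ∀ i, MemLp (fun x => fderiv ℝ (fun y => fderiv ℝ η y (stdOrthonormalBasis ℝ E i)) x
      (stdOrthonormalBasis ℝ E i)) 2 volume) :
    Integrable (fun x => ⟪η x, (Δ η) x⟫) volume := by
  have hη2 : ContDiff ℝ 2 η := hη.of_le (by norm_cast)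
  have hΔ : MemLp (Δ η) 2 volume := by
    have : Δ η = fun x => ∑ i, fderiv ℝ (fun y => fderiv ℝ η y (stdOrthonormalBasis ℝ E i)) x
        (stdOrthonormalBasis ℝ E i) := funext (laplacian_eq_sum_fderiv_fderiv _ hη2)
    rw [this]
    exact memLp_finsetSum _ fun i _ => h2 i
  exact integrable_inner_of_memLp_two h0 hΔ

/-- `⟪η, (Ū·∇)η⟫ ∈ L¹` when `η, ∂ᵢη ∈ L²` and `Ū` is bounded and continuous. [folklore] -/
theorem integrable_inner_fderiv_apply_drift (hη : ContDiff ℝ ∞ η) (h0 : MemLp η 2 volume)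
    (h1 : ∀ i, MemLp (fun x => fderiv ℝ η x (stdOrthonormalBasis ℝ E i)) 2 volume)
    (hUc : Continuous Ubar) {M₀ : ℝ} (hM₀ : ∀ x, ‖Ubar x‖ ≤ M₀) :
    Integrable (fun x => ⟪η x, fderiv ℝ η x (Ubar x)⟫) volume := by
  set b := stdOrthonormalBasis ℝ E with hb
  have hηc : Continuous η := hη.continuous
  have hUη : ∀ i, MemLp (fun x => ⟪b i, Ubar x⟫ • η x) 2 volume := by
    intro i
    refine h0.of_le_mul (c := M₀) ((continuous_const.inner hUc).smul hηc).aestronglyMeasurable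
      (Eventually.of_forall fun x => ?_)
    rw [norm_smul]
    exact mul_le_mul_of_nonneg_right
      ((abs_real_inner_le_norm _ _).trans (by rw [b.orthonormal.1 i, one_mul]; exact hM₀ x))
      (norm_nonneg _)
  have hD : ∀ i, Integrable (fun x => ⟪b i, Ubar x⟫ * ⟪η x, fderiv ℝ η x (b i)⟫) volume := fun i =>
    (integrable_inner_of_memLp_two (hUη i) (h1 i)).congr
      (Eventually.of_forall fun x => by simp only [real_inner_smul_left])
  refine (integrable_finsetSum Finset.univ fun i _ => hD i).congr
    (Eventually.of_forall fun x => ?_)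
  exact (inner_fderiv_apply_eq_sum η x (Ubar x) (η x)).symm

/-- `⟪η, DŪ η⟫ ∈ L¹` when `η ∈ L²` and `DŪ` is bounded and continuous. [folklore] -/
theorem integrable_inner_fderiv_apply_stretch (hη : ContDiff ℝ ∞ η) (h0 : MemLp η 2 volume)
    (hDUc : Continuous (fderiv ℝ Ubar)) {M₁ : ℝ} (hM₁ : ∀ x, ‖fderiv ℝ Ubar x‖ ≤ M₁) :
    Integrable (fun x => ⟪η x, fderiv ℝ Ubar x (η x)⟫) volume := by
  have hηc : Continuous η := hη.continuous
  have hA : Integrable (fun x => ‖η x‖ ^ 2) volume := (memLp_two_iff_integrable_sq_norm h0.1).1 h0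
  refine (hA.const_mul M₁).mono' (hηc.inner (hDUc.clm_apply hηc)).aestronglyMeasurable
    (Eventually.of_forall fun x => ?_)
  calc ‖⟪η x, fderiv ℝ Ubar x (η x)⟫‖ ≤ ‖η x‖ * ‖fderiv ℝ Ubar x (η x)‖ := norm_inner_le_norm _ _
    _ ≤ ‖η x‖ * (‖fderiv ℝ Ubar x‖ * ‖η x‖) :=
        mul_le_mul_of_nonneg_left (ContinuousLinearMap.le_opNorm _ _) (norm_nonneg _)
    _ ≤ ‖η x‖ * (M₁ * ‖η x‖) :=
        mul_le_mul_of_nonneg_left (mul_le_mul_of_nonneg_right (hM₁ x) (norm_nonneg _))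
          (norm_nonneg _)
    _ = M₁ * ‖η x‖ ^ 2 := by ring

/-- `⟪η, DŪ η⟫ ≥ −M‖η‖²` pointwise integrates to `∫⟪η, DŪ η⟫ ≥ −M ∫‖η‖²`. [folklore] -/
theorem neg_mul_integral_le_integral_inner_stretch (hη : ContDiff ℝ ∞ η) (h0 : MemLp η 2 volume)
    (hDUc : Continuous (fderiv ℝ Ubar)) {M₁ : ℝ} (hM₁ : ∀ x, ‖fderiv ℝ Ubar x‖ ≤ M₁) {M : ℝ}
    (hM : ∀ x w, -(M * ‖w‖ ^ 2) ≤ ⟪w, fderiv ℝ Ubar x w⟫) :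
    -(M * ∫ x, ‖η x‖ ^ 2) ≤ ∫ x, ⟪η x, fderiv ℝ Ubar x (η x)⟫ := by
  have hA : Integrable (fun x => ‖η x‖ ^ 2) volume := (memLp_two_iff_integrable_sq_norm h0.1).1 h0
  rw [← integral_const_mul, ← integral_neg]
  exact integral_mono (hA.const_mul M).neg (integrable_inner_fderiv_apply_stretch hη h0 hDUc hM₁)
    fun x => hM x (η x)

/-- `⟪η, ∇q⟫ ∈ L¹` when `η, ∂ᵢq ∈ L²`. [folklore] -/
theorem integrable_inner_gradient (hη : ContDiff ℝ ∞ η) (h0 : MemLp η 2 volume)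
    (hq1 : ∀ i, MemLp (fun x => fderiv ℝ q x (stdOrthonormalBasis ℝ E i)) 2 volume) :
    Integrable (fun x => ⟪η x, gradient q x⟫) volume := by
  set b := stdOrthonormalBasis ℝ E with hb
  have hηc : Continuous η := hη.continuous
  have hηi : ∀ i, MemLp (fun x => ⟪b i, η x⟫) 2 volume := by
    intro i
    refine h0.of_le_mul (c := 1) (continuous_const.inner hηc).aestronglyMeasurable
      (Eventually.of_forall fun x => ?_)
    calc ‖⟪b i, η x⟫‖ ≤ ‖b i‖ * ‖η x‖ := norm_inner_le_norm _ _
      _ = 1 * ‖η x‖ := by rw [b.orthonormal.1 i]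
  have hQ : ∀ i, Integrable (fun x => fderiv ℝ q x (b i) * ⟪b i, η x⟫) volume := fun i =>
    (integrable_inner_of_memLp_two (hq1 i) (hηi i)).congr
      (Eventually.of_forall fun x => by simp only [RCLike.inner_apply, conj_trivial, mul_comm])
  refine (integrable_finsetSum Finset.univ fun i _ => hQ i).congr
    (Eventually.of_forall fun x => ?_)
  change ∑ i, fderiv ℝ q x (b i) * ⟪b i, η x⟫ = ⟪η x, gradient q x⟫
  rw [inner_gradient_eq_fderiv_apply, clm_apply_eq_sum_inner_smul (fderiv ℝ q x) (η x)]
  exact Finset.sum_congr rfl fun i _ => by rw [smul_eq_mul, mul_comm]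

end Integrability

/-! ### The quadratic form of `N_Ū` -/

/-- **The quadratic form of the stationary linearised operator.** For `N_Ū(η) = −½(η + Dη·ξ) −
Δη + Ū·∇η + η·∇Ū` (`steadyLinearizedResidual`, [ABC] (1.10) without the projection), a smooth
`η` with `η, ∂ᵢη, ∂ᵢ∂ᵢη, ξᵢη, ξᵢ∂ᵢη ∈ L²` and a smooth bounded divergence-free `Ū` with bounded
derivative,

  `∫ ⟪η, N_Ū(η)⟫ = (n/4 − ½) ‖η‖² + ‖∇η‖² + ∫ ⟪η, DŪ η⟫`

(`n = dim E`; on `ℝ³` the constant is `¼`): the four integrations by parts of this file.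
This is the energy estimate `Re⟨−L_ss U, U⟩ ≥ ¼‖U‖² + ‖∇U‖² − ‖sym ∇Ū‖_∞‖U‖²` of [ABC] §4.1 /
Jia–Šverák 2015 in identity form. [cite: AlbrittonBrueColombo2022AnnMath, §4.1 (energy estimate after Prop. 4.3)] -/
theorem integral_inner_steadyLinearizedResidual_self {η Ubar : E → E} (hη : ContDiff ℝ ∞ η)
    (h0 : MemLp η 2 volume)
    (h1 : ∀ i, MemLp (fun x => fderiv ℝ η x (stdOrthonormalBasis ℝ E i)) 2 volume)
    (h2 : ∀ i, MemLp (fun x => fderiv ℝ (fun y => fderiv ℝ η y (stdOrthonormalBasis ℝ E i)) x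
      (stdOrthonormalBasis ℝ E i)) 2 volume)
    (hw0 : ∀ i, MemLp (fun x => ⟪stdOrthonormalBasis ℝ E i, x⟫ • η x) 2 volume)
    (hw1 : ∀ i, MemLp (fun x => ⟪stdOrthonormalBasis ℝ E i, x⟫ •
      fderiv ℝ η x (stdOrthonormalBasis ℝ E i)) 2 volume)
    (hU : ContDiff ℝ ∞ Ubar) (hUdiv : VectorCalculus.IsDivFree Ubar) {M₀ M₁ : ℝ}
    (hM₀ : ∀ x, ‖Ubar x‖ ≤ M₀) (hM₁ : ∀ x, ‖fderiv ℝ Ubar x‖ ≤ M₁) :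
    ∫ x, ⟪η x, steadyLinearizedResidual Ubar η x⟫ =
      ((Module.finrank ℝ E : ℝ) / 4 - 1 / 2) * (∫ x, ‖η x‖ ^ 2) +
        (∫ x, frobeniusNormSq (fderiv ℝ η x)) + ∫ x, ⟪η x, fderiv ℝ Ubar x (η x)⟫ := by
  have hUc : Continuous Ubar := hU.continuous
  have hDUc : Continuous (fderiv ℝ Ubar) := hU.continuous_fderiv (by simp)
  -- the five integrable pieces
  have hA : Integrable (fun x => ‖η x‖ ^ 2) volume := (memLp_two_iff_integrable_sq_norm h0.1).1 h0
  have hB := integrable_inner_fderiv_apply_self h1 hw0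
  have hL := integrable_inner_laplacian_self hη h0 h2
  have hT := integrable_inner_fderiv_apply_drift hη h0 h1 hUc hM₀
  have hS := integrable_inner_fderiv_apply_stretch hη h0 hDUc hM₁
  -- pointwise expansion of `⟪η, N η⟫`
  have hpt : ∀ x, ⟪η x, steadyLinearizedResidual Ubar η x⟫ =
      -((2⁻¹ : ℝ) * (‖η x‖ ^ 2 + ⟪η x, fderiv ℝ η x x⟫)) - ⟪η x, (Δ η) x⟫ +
        (⟪η x, fderiv ℝ η x (Ubar x)⟫ + ⟪η x, fderiv ℝ Ubar x (η x)⟫) := by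
    intro x
    rw [steadyLinearizedResidual_apply]
    simp only [inner_add_right, inner_sub_right, inner_neg_right, real_inner_smul_right,
      real_inner_self_eq_norm_sq, convect_apply, mul_add]
  have hAB : Integrable (fun x => ‖η x‖ ^ 2 + ⟪η x, fderiv ℝ η x x⟫) volume := hA.add hB
  have hI1 : Integrable (fun x => -((2⁻¹ : ℝ) * (‖η x‖ ^ 2 + ⟪η x, fderiv ℝ η x x⟫))) volume :=
    (hAB.const_mul _).neg
  have hI2 : Integrable (fun x => -((2⁻¹ : ℝ) * (‖η x‖ ^ 2 + ⟪η x, fderiv ℝ η x x⟫)) -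
      ⟪η x, (Δ η) x⟫) volume := hI1.sub hL
  have hTS : Integrable (fun x => ⟪η x, fderiv ℝ η x (Ubar x)⟫ + ⟪η x, fderiv ℝ Ubar x (η x)⟫)
      volume := hT.add hS
  simp_rw [hpt]
  rw [integral_add hI2 hTS, integral_sub hI1 hL, integral_neg, integral_const_mul,
    integral_add hA hB, integral_add hT hS,
    integral_inner_fderiv_apply_self_eq hη h0 h1 hw0 hw1,
    integral_inner_laplacian_self_eq hη h0 h1 h2,
    integral_inner_fderiv_apply_of_isDivFree_eq_zero hη h0 h1 hU hUdiv hM₀ hM₁]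
  ring

/-! ### The energy identity of an eigenmode and the bound on `Re λ` -/

/-- **Energy identity of an eigenmode of `L_ss` (Albritton–Brué–Colombo 2022, the energy estimate
of §4.1 applied to `L_ss η = λη`).** Let `Ū` be smooth, bounded with bounded derivative and
divergence free, and let smooth divergence-free `η₁, η₂` and smooth `q₁, q₂` solve the real form of
the eigenvalue problem `λη + N_Ū(η) + ∇q = 0`, `λ = a + ib`, `η = η₁ + iη₂` (as in
`albritton_brue_colombo_unit_of_unstableMode`):
`aη₁ − bη₂ + N_Ū(η₁) + ∇q₁ = 0`, `bη₁ + aη₂ + N_Ū(η₂) + ∇q₂ = 0`, with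
`ηⱼ, ∂ᵢηⱼ, ∂ᵢ∂ᵢηⱼ, ξᵢηⱼ, ξᵢ∂ᵢηⱼ, qⱼ, ∂ᵢqⱼ ∈ L²`. Then

  `(a + n/4 − ½)(‖η₁‖² + ‖η₂‖²) + (‖∇η₁‖² + ‖∇η₂‖²) + ∫⟪η₁, DŪ η₁⟫ + ∫⟪η₂, DŪ η₂⟫ = 0`

(pair the equations with `η₁`, `η₂`, integrate, use `integral_inner_steadyLinearizedResidual_self`
and `∫⟪ηⱼ, ∇qⱼ⟫ = 0`; the `b`-terms cancel). [cite: AlbrittonBrueColombo2022AnnMath, §4.1 (energy estimate after Prop. 4.3) with (1.10)] -/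
theorem energy_identity_of_unstableMode {Ubar : E → E} (hU : ContDiff ℝ ∞ Ubar)
    (hUdiv : VectorCalculus.IsDivFree Ubar) {M₀ M₁ : ℝ} (hM₀ : ∀ x, ‖Ubar x‖ ≤ M₀)
    (hM₁ : ∀ x, ‖fderiv ℝ Ubar x‖ ≤ M₁) {a b : ℝ} {η₁ η₂ : E → E} {q₁ q₂ : E → ℝ}
    (hη₁ : ContDiff ℝ ∞ η₁) (hη₂ : ContDiff ℝ ∞ η₂) (hq₁ : ContDiff ℝ ∞ q₁) (hq₂ : ContDiff ℝ ∞ q₂)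
    (hdiv₁ : VectorCalculus.IsDivFree η₁) (hdiv₂ : VectorCalculus.IsDivFree η₂)
    (heig₁ : ∀ ξ, a • η₁ ξ - b • η₂ ξ + steadyLinearizedResidual Ubar η₁ ξ + gradient q₁ ξ = 0)
    (heig₂ : ∀ ξ, b • η₁ ξ + a • η₂ ξ + steadyLinearizedResidual Ubar η₂ ξ + gradient q₂ ξ = 0)
    (h0₁ : MemLp η₁ 2 volume) (h0₂ : MemLp η₂ 2 volume)
    (h1₁ : ∀ i, MemLp (fun x => fderiv ℝ η₁ x (stdOrthonormalBasis ℝ E i)) 2 volume)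
    (h1₂ : ∀ i, MemLp (fun x => fderiv ℝ η₂ x (stdOrthonormalBasis ℝ E i)) 2 volume)
    (h2₁ : ∀ i, MemLp (fun x => fderiv ℝ (fun y => fderiv ℝ η₁ y (stdOrthonormalBasis ℝ E i)) x
      (stdOrthonormalBasis ℝ E i)) 2 volume)
    (h2₂ : ∀ i, MemLp (fun x => fderiv ℝ (fun y => fderiv ℝ η₂ y (stdOrthonormalBasis ℝ E i)) x
      (stdOrthonormalBasis ℝ E i)) 2 volume)
    (hw0₁ : ∀ i, MemLp (fun x => ⟪stdOrthonormalBasis ℝ E i, x⟫ • η₁ x) 2 volume)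
    (hw0₂ : ∀ i, MemLp (fun x => ⟪stdOrthonormalBasis ℝ E i, x⟫ • η₂ x) 2 volume)
    (hw1₁ : ∀ i, MemLp (fun x => ⟪stdOrthonormalBasis ℝ E i, x⟫ •
      fderiv ℝ η₁ x (stdOrthonormalBasis ℝ E i)) 2 volume)
    (hw1₂ : ∀ i, MemLp (fun x => ⟪stdOrthonormalBasis ℝ E i, x⟫ •
      fderiv ℝ η₂ x (stdOrthonormalBasis ℝ E i)) 2 volume)
    (hp0₁ : MemLp q₁ 2 volume) (hp0₂ : MemLp q₂ 2 volume)
    (hp1₁ : ∀ i, MemLp (fun x => fderiv ℝ q₁ x (stdOrthonormalBasis ℝ E i)) 2 volume)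
    (hp1₂ : ∀ i, MemLp (fun x => fderiv ℝ q₂ x (stdOrthonormalBasis ℝ E i)) 2 volume) :
    (a + ((Module.finrank ℝ E : ℝ) / 4 - 1 / 2)) * ((∫ x, ‖η₁ x‖ ^ 2) + ∫ x, ‖η₂ x‖ ^ 2) +
      ((∫ x, frobeniusNormSq (fderiv ℝ η₁ x)) + ∫ x, frobeniusNormSq (fderiv ℝ η₂ x)) +
      ((∫ x, ⟪η₁ x, fderiv ℝ Ubar x (η₁ x)⟫) + ∫ x, ⟪η₂ x, fderiv ℝ Ubar x (η₂ x)⟫) = 0 := by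
  have hUc : Continuous Ubar := hU.continuous
  have hDUc : Continuous (fderiv ℝ Ubar) := hU.continuous_fderiv (by simp)
  -- integrable pieces
  have hA₁ : Integrable (fun x => ‖η₁ x‖ ^ 2) volume :=
    (memLp_two_iff_integrable_sq_norm h0₁.1).1 h0₁
  have hA₂ : Integrable (fun x => ‖η₂ x‖ ^ 2) volume :=
    (memLp_two_iff_integrable_sq_norm h0₂.1).1 h0₂
  have hX₁₂ : Integrable (fun x => ⟪η₁ x, η₂ x⟫) volume := integrable_inner_of_memLp_two h0₁ h0₂
  have hX₂₁ : Integrable (fun x => ⟪η₂ x, η₁ x⟫) volume := integrable_inner_of_memLp_two h0₂ h0₁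
  have hQ₁ := integrable_inner_gradient hη₁ h0₁ hp1₁
  have hQ₂ := integrable_inner_gradient hη₂ h0₂ hp1₂
  -- `⟪ηⱼ, N ηⱼ⟫` is integrable, being minus the other (integrable) terms of the equation
  have e₁ : ∀ x, a * ‖η₁ x‖ ^ 2 - b * ⟪η₁ x, η₂ x⟫ + ⟪η₁ x, steadyLinearizedResidual Ubar η₁ x⟫ +
      ⟪η₁ x, gradient q₁ x⟫ = 0 := by
    intro x
    have h := congrArg (fun v => ⟪η₁ x, v⟫) (heig₁ x)
    simpa only [inner_add_right, inner_sub_right, real_inner_smul_right, inner_zero_right,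
      real_inner_self_eq_norm_sq] using h
  have e₂ : ∀ x, b * ⟪η₂ x, η₁ x⟫ + a * ‖η₂ x‖ ^ 2 + ⟪η₂ x, steadyLinearizedResidual Ubar η₂ x⟫ +
      ⟪η₂ x, gradient q₂ x⟫ = 0 := by
    intro x
    have h := congrArg (fun v => ⟪η₂ x, v⟫) (heig₂ x)
    simpa only [inner_add_right, real_inner_smul_right, inner_zero_right,
      real_inner_self_eq_norm_sq] using h
  have hN₁ : Integrable (fun x => ⟪η₁ x, steadyLinearizedResidual Ubar η₁ x⟫) volume := by
    have : (fun x => ⟪η₁ x, steadyLinearizedResidual Ubar η₁ x⟫) =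
        fun x => -(a * ‖η₁ x‖ ^ 2 - b * ⟪η₁ x, η₂ x⟫) - ⟪η₁ x, gradient q₁ x⟫ := by
      funext x; linarith [e₁ x]
    rw [this]
    exact ((hA₁.const_mul a).sub (hX₁₂.const_mul b)).neg.sub hQ₁
  have hN₂ : Integrable (fun x => ⟪η₂ x, steadyLinearizedResidual Ubar η₂ x⟫) volume := by
    have : (fun x => ⟪η₂ x, steadyLinearizedResidual Ubar η₂ x⟫) =
        fun x => -(b * ⟪η₂ x, η₁ x⟫ + a * ‖η₂ x‖ ^ 2) - ⟪η₂ x, gradient q₂ x⟫ := by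
      funext x; linarith [e₂ x]
    rw [this]
    exact ((hX₂₁.const_mul b).add (hA₂.const_mul a)).neg.sub hQ₂
  -- integrate the two equations
  have hI₁a : Integrable (fun x => a * ‖η₁ x‖ ^ 2) volume := hA₁.const_mul a
  have hI₁b : Integrable (fun x => b * ⟪η₁ x, η₂ x⟫) volume := hX₁₂.const_mul b
  have hI₁ab : Integrable (fun x => a * ‖η₁ x‖ ^ 2 - b * ⟪η₁ x, η₂ x⟫) volume := hI₁a.sub hI₁b
  have hI₁abN : Integrable (fun x => a * ‖η₁ x‖ ^ 2 - b * ⟪η₁ x, η₂ x⟫ +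
      ⟪η₁ x, steadyLinearizedResidual Ubar η₁ x⟫) volume := hI₁ab.add hN₁
  have I₁ : a * (∫ x, ‖η₁ x‖ ^ 2) - b * (∫ x, ⟪η₁ x, η₂ x⟫) +
      (∫ x, ⟪η₁ x, steadyLinearizedResidual Ubar η₁ x⟫) + ∫ x, ⟪η₁ x, gradient q₁ x⟫ = 0 := by
    rw [← integral_const_mul, ← integral_const_mul, ← integral_sub hI₁a hI₁b,
      ← integral_add hI₁ab hN₁, ← integral_add hI₁abN hQ₁]
    simp only [e₁, integral_zero]
  have hI₂a : Integrable (fun x => b * ⟪η₂ x, η₁ x⟫) volume := hX₂₁.const_mul b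
  have hI₂b : Integrable (fun x => a * ‖η₂ x‖ ^ 2) volume := hA₂.const_mul a
  have hI₂ab : Integrable (fun x => b * ⟪η₂ x, η₁ x⟫ + a * ‖η₂ x‖ ^ 2) volume := hI₂a.add hI₂b
  have hI₂abN : Integrable (fun x => b * ⟪η₂ x, η₁ x⟫ + a * ‖η₂ x‖ ^ 2 +
      ⟪η₂ x, steadyLinearizedResidual Ubar η₂ x⟫) volume := hI₂ab.add hN₂
  have I₂ : b * (∫ x, ⟪η₂ x, η₁ x⟫) + a * (∫ x, ‖η₂ x‖ ^ 2) +
      (∫ x, ⟪η₂ x, steadyLinearizedResidual Ubar η₂ x⟫) + ∫ x, ⟪η₂ x, gradient q₂ x⟫ = 0 := by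
    rw [← integral_const_mul, ← integral_const_mul, ← integral_add hI₂a hI₂b,
      ← integral_add hI₂ab hN₂, ← integral_add hI₂abN hQ₂]
    simp only [e₂, integral_zero]
  have hX : ∫ x, ⟪η₂ x, η₁ x⟫ = ∫ x, ⟪η₁ x, η₂ x⟫ :=
    integral_congr_ae (Eventually.of_forall fun x => real_inner_comm _ _)
  have hP₁ : ∫ x, ⟪η₁ x, gradient q₁ x⟫ = 0 :=
    integral_inner_gradient_eq_zero_of_isDivFree hη₁ hdiv₁ h0₁ h1₁ hq₁ hp0₁ hp1₁
  have hP₂ : ∫ x, ⟪η₂ x, gradient q₂ x⟫ = 0 :=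
    integral_inner_gradient_eq_zero_of_isDivFree hη₂ hdiv₂ h0₂ h1₂ hq₂ hp0₂ hp1₂
  have hR₁ := integral_inner_steadyLinearizedResidual_self hη₁ h0₁ h1₁ h2₁ hw0₁ hw1₁ hU hUdiv hM₀ hM₁
  have hR₂ := integral_inner_steadyLinearizedResidual_self hη₂ h0₂ h1₂ h2₂ hw0₂ hw1₂ hU hUdiv hM₀ hM₁
  rw [hX] at I₂
  linear_combination I₁ + I₂ - hR₁ - hR₂ - hP₁ - hP₂

/-- The squared `L²` norm of a continuous field which does not vanish identically is positive.
[folklore] -/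
theorem integral_norm_sq_pos_of_ne_zero {η : E → E} (hηc : Continuous η)
    (hA : Integrable (fun x => ‖η x‖ ^ 2) volume) (hne : ∃ ξ₀, η ξ₀ ≠ 0) :
    0 < ∫ x, ‖η x‖ ^ 2 := by
  obtain ⟨ξ₀, hξ₀⟩ := hne
  have hnn : 0 ≤ fun x => ‖η x‖ ^ 2 := fun x => by positivity
  rw [integral_pos_iff_support_of_nonneg hnn hA]
  have hopen : IsOpen (Function.support fun x => ‖η x‖ ^ 2) :=
    isOpen_compl_singleton.preimage (hηc.norm.pow 2)
  exact hopen.measure_pos volume ⟨ξ₀, Function.mem_support.2 (pow_ne_zero 2 (norm_ne_zero_iff.2 hξ₀))⟩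

/-- **A-priori bound on the real part of an eigenvalue of `L_ss` (Albritton–Brué–Colombo 2022,
§4.1 / Jia–Šverák 2015: the energy estimate).** In the situation of
`energy_identity_of_unstableMode`, if the symmetric part of `∇Ū` is bounded below,
`⟪w, DŪ(ξ) w⟫ ≥ −M‖w‖²` for all `ξ, w`, and `η₁ ≢ 0`, then

  `a + n/4 − ½ ≤ M`,  i.e. `Re λ ≤ M − (n/4 − ½)`  (`= M − ¼` on `ℝ³`).

In particular an unstable or neutral mode (`a ≥ 0`) forces `sup_ξ ‖sym ∇Ū(ξ)‖ ≥ n/4 − ½`: the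
instability behind [ABC] Thm. 1.3 (a) is an `O(1)` effect of the background (there `Ū = βŪ₀`,
`β ≫ 1`), never a perturbation of the Gaussian similarity profile flow.
[cite: AlbrittonBrueColombo2022AnnMath, §4.1 (energy estimate after Prop. 4.3; ω_ess(L_ss) ≤ −1/4)] -/
theorem re_eigenvalue_le_of_unstableMode {Ubar : E → E} (hU : ContDiff ℝ ∞ Ubar)
    (hUdiv : VectorCalculus.IsDivFree Ubar) {M₀ M₁ : ℝ} (hM₀ : ∀ x, ‖Ubar x‖ ≤ M₀)
    (hM₁ : ∀ x, ‖fderiv ℝ Ubar x‖ ≤ M₁) {M : ℝ} (hM : ∀ x w, -(M * ‖w‖ ^ 2) ≤ ⟪w, fderiv ℝ Ubar x w⟫)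
    {a b : ℝ} {η₁ η₂ : E → E} {q₁ q₂ : E → ℝ}
    (hη₁ : ContDiff ℝ ∞ η₁) (hη₂ : ContDiff ℝ ∞ η₂) (hq₁ : ContDiff ℝ ∞ q₁) (hq₂ : ContDiff ℝ ∞ q₂)
    (hdiv₁ : VectorCalculus.IsDivFree η₁) (hdiv₂ : VectorCalculus.IsDivFree η₂)
    (heig₁ : ∀ ξ, a • η₁ ξ - b • η₂ ξ + steadyLinearizedResidual Ubar η₁ ξ + gradient q₁ ξ = 0)
    (heig₂ : ∀ ξ, b • η₁ ξ + a • η₂ ξ + steadyLinearizedResidual Ubar η₂ ξ + gradient q₂ ξ = 0)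
    (h0₁ : MemLp η₁ 2 volume) (h0₂ : MemLp η₂ 2 volume)
    (h1₁ : ∀ i, MemLp (fun x => fderiv ℝ η₁ x (stdOrthonormalBasis ℝ E i)) 2 volume)
    (h1₂ : ∀ i, MemLp (fun x => fderiv ℝ η₂ x (stdOrthonormalBasis ℝ E i)) 2 volume)
    (h2₁ : ∀ i, MemLp (fun x => fderiv ℝ (fun y => fderiv ℝ η₁ y (stdOrthonormalBasis ℝ E i)) x
      (stdOrthonormalBasis ℝ E i)) 2 volume)
    (h2₂ : ∀ i, MemLp (fun x => fderiv ℝ (fun y => fderiv ℝ η₂ y (stdOrthonormalBasis ℝ E i)) x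
      (stdOrthonormalBasis ℝ E i)) 2 volume)
    (hw0₁ : ∀ i, MemLp (fun x => ⟪stdOrthonormalBasis ℝ E i, x⟫ • η₁ x) 2 volume)
    (hw0₂ : ∀ i, MemLp (fun x => ⟪stdOrthonormalBasis ℝ E i, x⟫ • η₂ x) 2 volume)
    (hw1₁ : ∀ i, MemLp (fun x => ⟪stdOrthonormalBasis ℝ E i, x⟫ •
      fderiv ℝ η₁ x (stdOrthonormalBasis ℝ E i)) 2 volume)
    (hw1₂ : ∀ i, MemLp (fun x => ⟪stdOrthonormalBasis ℝ E i, x⟫ •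
      fderiv ℝ η₂ x (stdOrthonormalBasis ℝ E i)) 2 volume)
    (hp0₁ : MemLp q₁ 2 volume) (hp0₂ : MemLp q₂ 2 volume)
    (hp1₁ : ∀ i, MemLp (fun x => fderiv ℝ q₁ x (stdOrthonormalBasis ℝ E i)) 2 volume)
    (hp1₂ : ∀ i, MemLp (fun x => fderiv ℝ q₂ x (stdOrthonormalBasis ℝ E i)) 2 volume)
    (hne : ∃ ξ₀, η₁ ξ₀ ≠ 0) :
    a + ((Module.finrank ℝ E : ℝ) / 4 - 1 / 2) ≤ M := by
  have hDUc : Continuous (fderiv ℝ Ubar) := hU.continuous_fderiv (by simp)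
  have hid := energy_identity_of_unstableMode hU hUdiv hM₀ hM₁ hη₁ hη₂ hq₁ hq₂ hdiv₁ hdiv₂ heig₁ heig₂
    h0₁ h0₂ h1₁ h1₂ h2₁ h2₂ hw0₁ hw0₂ hw1₁ hw1₂ hp0₁ hp0₂ hp1₁ hp1₂
  have hA₁ : Integrable (fun x => ‖η₁ x‖ ^ 2) volume :=
    (memLp_two_iff_integrable_sq_norm h0₁.1).1 h0₁
  have hpos : 0 < ∫ x, ‖η₁ x‖ ^ 2 := integral_norm_sq_pos_of_ne_zero hη₁.continuous hA₁ hne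
  have hA₂ : 0 ≤ ∫ x, ‖η₂ x‖ ^ 2 := integral_nonneg fun x => by positivity
  have hF₁ : 0 ≤ ∫ x, frobeniusNormSq (fderiv ℝ η₁ x) :=
    integral_nonneg fun x => frobeniusNormSq_nonneg _
  have hF₂ : 0 ≤ ∫ x, frobeniusNormSq (fderiv ℝ η₂ x) :=
    integral_nonneg fun x => frobeniusNormSq_nonneg _
  have hS₁ := neg_mul_integral_le_integral_inner_stretch hη₁ h0₁ hDUc hM₁ hM
  have hS₂ := neg_mul_integral_le_integral_inner_stretch hη₂ h0₂ hDUc hM₁ hM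
  by_contra hlt
  have hlt' : M < a + ((Module.finrank ℝ E : ℝ) / 4 - 1 / 2) := not_le.mp hlt
  nlinarith [mul_pos (sub_pos.2 hlt') (add_pos_of_pos_of_nonneg hpos hA₂)]

/-- **The bound on `ℝ³` as printed: `Re λ ≤ sup(−sym ∇Ū) − ¼`.** Specialisation of
`re_eigenvalue_le_of_unstableMode` to `E = ℝ³` (`n/4 − ½ = ¼`): for an eigenmode of
`L_ss` at a smooth bounded divergence-free `Ū : ℝ³ → ℝ³` with `sym ∇Ū ≥ −M` and `η₁ ≢ 0`,
`a ≤ M − ¼`. With `M < ¼` no neutral or unstable mode (`a ≥ 0`) exists — the in-tree form of the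
[ABC]/Jia–Šverák bound `ω_ess(L_ss) ≤ −¼` at the level of eigenmodes.
[cite: AlbrittonBrueColombo2022AnnMath, §4.1 (energy estimate after Prop. 4.3; ω_ess(L_ss) ≤ −1/4)] -/
theorem re_eigenvalue_le_of_unstableMode_fin3
    {Ubar : EuclideanSpace ℝ (Fin 3) → EuclideanSpace ℝ (Fin 3)} (hU : ContDiff ℝ ∞ Ubar)
    (hUdiv : VectorCalculus.IsDivFree Ubar) {M₀ M₁ : ℝ} (hM₀ : ∀ x, ‖Ubar x‖ ≤ M₀)
    (hM₁ : ∀ x, ‖fderiv ℝ Ubar x‖ ≤ M₁) {M : ℝ} (hM : ∀ x w, -(M * ‖w‖ ^ 2) ≤ ⟪w, fderiv ℝ Ubar x w⟫)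
    {a b : ℝ} {η₁ η₂ : EuclideanSpace ℝ (Fin 3) → EuclideanSpace ℝ (Fin 3)}
    {q₁ q₂ : EuclideanSpace ℝ (Fin 3) → ℝ}
    (hη₁ : ContDiff ℝ ∞ η₁) (hη₂ : ContDiff ℝ ∞ η₂) (hq₁ : ContDiff ℝ ∞ q₁) (hq₂ : ContDiff ℝ ∞ q₂)
    (hdiv₁ : VectorCalculus.IsDivFree η₁) (hdiv₂ : VectorCalculus.IsDivFree η₂)
    (heig₁ : ∀ ξ, a • η₁ ξ - b • η₂ ξ + steadyLinearizedResidual Ubar η₁ ξ + gradient q₁ ξ = 0)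
    (heig₂ : ∀ ξ, b • η₁ ξ + a • η₂ ξ + steadyLinearizedResidual Ubar η₂ ξ + gradient q₂ ξ = 0)
    (h0₁ : MemLp η₁ 2 volume) (h0₂ : MemLp η₂ 2 volume)
    (h1₁ : ∀ i, MemLp (fun x => fderiv ℝ η₁ x (stdOrthonormalBasis ℝ _ i)) 2 volume)
    (h1₂ : ∀ i, MemLp (fun x => fderiv ℝ η₂ x (stdOrthonormalBasis ℝ _ i)) 2 volume)
    (h2₁ : ∀ i, MemLp (fun x => fderiv ℝ (fun y => fderiv ℝ η₁ y (stdOrthonormalBasis ℝ _ i)) x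
      (stdOrthonormalBasis ℝ _ i)) 2 volume)
    (h2₂ : ∀ i, MemLp (fun x => fderiv ℝ (fun y => fderiv ℝ η₂ y (stdOrthonormalBasis ℝ _ i)) x
      (stdOrthonormalBasis ℝ _ i)) 2 volume)
    (hw0₁ : ∀ i, MemLp (fun x => ⟪stdOrthonormalBasis ℝ _ i, x⟫ • η₁ x) 2 volume)
    (hw0₂ : ∀ i, MemLp (fun x => ⟪stdOrthonormalBasis ℝ _ i, x⟫ • η₂ x) 2 volume)
    (hw1₁ : ∀ i, MemLp (fun x => ⟪stdOrthonormalBasis ℝ _ i, x⟫ •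
      fderiv ℝ η₁ x (stdOrthonormalBasis ℝ _ i)) 2 volume)
    (hw1₂ : ∀ i, MemLp (fun x => ⟪stdOrthonormalBasis ℝ _ i, x⟫ •
      fderiv ℝ η₂ x (stdOrthonormalBasis ℝ _ i)) 2 volume)
    (hp0₁ : MemLp q₁ 2 volume) (hp0₂ : MemLp q₂ 2 volume)
    (hp1₁ : ∀ i, MemLp (fun x => fderiv ℝ q₁ x (stdOrthonormalBasis ℝ _ i)) 2 volume)
    (hp1₂ : ∀ i, MemLp (fun x => fderiv ℝ q₂ x (stdOrthonormalBasis ℝ _ i)) 2 volume)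
    (hne : ∃ ξ₀, η₁ ξ₀ ≠ 0) :
    a ≤ M - 1 / 4 := by
  have h := re_eigenvalue_le_of_unstableMode hU hUdiv hM₀ hM₁ hM hη₁ hη₂ hq₁ hq₂ hdiv₁ hdiv₂ heig₁
    heig₂ h0₁ h0₂ h1₁ h1₂ h2₁ h2₂ hw0₁ hw0₂ hw1₁ hw1₂ hp0₁ hp0₂ hp1₁ hp1₂ hne
  rw [finrank_euclideanSpace_fin] at h
  norm_num at h
  linarith

/-! ### The bound for the operator (1.10) verbatim: `negLss`, `Ū ∈ C_c^∞` -/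

section Verbatim

variable {G : EuclideanSpace ℝ (Fin 3) → EuclideanSpace ℝ (Fin 3)}

/-- A measurable function with `∫⁻ ‖f‖² < ∞` is in `L²` (local copy of the tree's
`memLp_two_of_lintegral_sq_lt_top`, `FujitaKatoL2Fourier.lean`, to keep imports light). [folklore] -/
private theorem memLp_two_of_lintegral_sq_lt_top' {X : Type*} [MeasurableSpace X] {μ : Measure X}
    {F : Type*} [NormedAddCommGroup F] {f : X → F}
    (hf : AEStronglyMeasurable f μ) (h2 : ∫⁻ ξ, ‖f ξ‖ₑ ^ 2 ∂μ < ⊤) : MemLp f 2 μ := by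
  refine ⟨hf, ?_⟩
  rw [eLpNorm_eq_lintegral_rpow_enorm_toReal (by norm_num) (by norm_num)]
  refine ENNReal.rpow_lt_top_of_nonneg (by norm_num) (ne_of_lt ?_)
  simpa using h2

/-- The divergence of a compactly supported field is compactly supported (local copy of the tree's
`hasCompactSupport_divergence`, `StokesWholeSpacePressure.lean`). [folklore] -/
private theorem hasCompactSupport_divergence_of (hGc : HasCompactSupport G) :
    HasCompactSupport (VectorCalculus.divergence G) :=
  hGc.mono' fun x hx => by
    by_contra h
    exact hx (divergence_eq_zero_of_notMem_tsupport h)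

/-- **Derivatives of the Newtonian potential of a divergence fall on the source:**
`∂ᵥ π[G] = π[∂ᵥ G]` for `G ∈ C_c^∞(ℝ³; ℝ³)` (`∂ᵥ((div G) ⋆ Γ) = (∂ᵥ div G) ⋆ Γ` and
`∂ᵥ div G = div ∂ᵥG`). [cite: GilbargTrudinger2001, Lemma 4.1] -/
theorem fderiv_divPotential_apply (hG : ContDiff ℝ ∞ G) (hGc : HasCompactSupport G)
    (x v : EuclideanSpace ℝ (Fin 3)) :
    fderiv ℝ (divPotential G) x v = divPotential (fun y => fderiv ℝ G y v) x := by
  have hG2 : ContDiff ℝ 2 G := hG.of_le (by norm_cast)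
  have hdiv1 : ContDiff ℝ 1 (VectorCalculus.divergence G) :=
    (contDiff_divergence_of_contDiff_top hG).of_le (by norm_cast)
  unfold divPotential
  rw [fderiv_convolution_newtonKernel_apply hdiv1 (hasCompactSupport_divergence_of hGc) x v]
  congr 1
  funext t
  exact (divergence_fderiv_apply hG2 t v).symm

/-- **`π[G] ∈ L²(ℝ³)`** as an `L²`-membership statement (`MemLp`), for `G ∈ C_c^∞`
(`lintegral_enorm_sq_divPotential_lt_top`). [folklore] -/
theorem memLp_divPotential (hG : ContDiff ℝ ∞ G) (hGc : HasCompactSupport G) :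
    MemLp (divPotential G) 2 volume :=
  memLp_two_of_lintegral_sq_lt_top' (contDiff_divPotential hG hGc).continuous.aestronglyMeasurable
    (lintegral_enorm_sq_divPotential_lt_top hG hGc)

/-- **`∂ᵥ π[G] ∈ L²(ℝ³)`** for `G ∈ C_c^∞`: `∂ᵥπ[G] = π[∂ᵥG]` is again the Newtonian potential of
the divergence of a test field. [folklore] -/
theorem memLp_fderiv_divPotential_apply (hG : ContDiff ℝ ∞ G) (hGc : HasCompactSupport G)
    (v : EuclideanSpace ℝ (Fin 3)) :
    MemLp (fun x => fderiv ℝ (divPotential G) x v) 2 volume := by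
  have hGv : ContDiff ℝ ∞ (fun y => fderiv ℝ G y v) :=
    (contDiff_infty_iff_fderiv.1 hG).2.clm_apply contDiff_const
  have hGvc : HasCompactSupport (fun y => fderiv ℝ G y v) := hGc.fderiv_apply (𝕜 := ℝ) v
  have heq : (fun x => fderiv ℝ (divPotential G) x v) = divPotential (fun y => fderiv ℝ G y v) :=
    funext fun x => fderiv_divPotential_apply hG hGc x v
  rw [heq]
  exact memLp_divPotential hGv hGvc

/-- **The a-priori bound `Re λ ≤ sup(−sym ∇Ū) − ¼` for eigenmodes of `L_ss` in the form (1.10)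
verbatim (Albritton–Brué–Colombo 2022, §4.1; Jia–Šverák 2015, Lemma 2.1).** Let
`Ū ∈ C_c^∞(ℝ³; ℝ³)` be divergence free with `⟪w, DŪ(ξ)w⟫ ≥ −M‖w‖²` for all `ξ, w`, and let smooth
divergence-free `η₁, η₂` with `ηⱼ, ∂ᵢηⱼ, ∂ᵢ∂ᵢηⱼ, ξᵢηⱼ, ξᵢ∂ᵢηⱼ ∈ L²` solve `L_ss η = λη` in real and
imaginary parts, `aη₁ − bη₂ + (−L_ss)η₁ = 0`, `bη₁ + aη₂ + (−L_ss)η₂ = 0` (`negLss`, the datum of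
`albritton_brue_colombo_unit_of_eigenmode`), `η₁ ≢ 0`. Then `a = Re λ ≤ M − ¼`. Proof:
`(−L_ss)η = N_Ū(η) + ∇q` with `q = −π[B(Ū, η)]` (`negLss_eq_steadyLinearizedResidual_sub`),
`q, ∂ᵢq ∈ L²` (`memLp_divPotential`, `memLp_fderiv_divPotential_apply`), `Ū, DŪ` bounded (compact
support), and `re_eigenvalue_le_of_unstableMode_fin3`. In particular the unstable mode of [ABC]
Thm. 1.3 (a) (`a > 0`) requires `sup_ξ(−sym ∇Ū(ξ)) > ¼`.
[cite: AlbrittonBrueColombo2022AnnMath, §4.1 (energy estimate after Prop. 4.3) with (1.10)] -/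
theorem re_eigenvalue_le_of_eigenmode
    {Ubar : EuclideanSpace ℝ (Fin 3) → EuclideanSpace ℝ (Fin 3)} (hUs : ContDiff ℝ ∞ Ubar)
    (hUc : HasCompactSupport Ubar) (hUdiv : VectorCalculus.IsDivFree Ubar) {M : ℝ}
    (hM : ∀ x w, -(M * ‖w‖ ^ 2) ≤ ⟪w, fderiv ℝ Ubar x w⟫) {a b : ℝ}
    {η₁ η₂ : EuclideanSpace ℝ (Fin 3) → EuclideanSpace ℝ (Fin 3)}
    (hη₁ : ContDiff ℝ ∞ η₁) (hη₂ : ContDiff ℝ ∞ η₂)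
    (hdiv₁ : VectorCalculus.IsDivFree η₁) (hdiv₂ : VectorCalculus.IsDivFree η₂)
    (heig₁ : ∀ ξ, a • η₁ ξ - b • η₂ ξ + negLss Ubar η₁ ξ = 0)
    (heig₂ : ∀ ξ, b • η₁ ξ + a • η₂ ξ + negLss Ubar η₂ ξ = 0)
    (h0₁ : MemLp η₁ 2 volume) (h0₂ : MemLp η₂ 2 volume)
    (h1₁ : ∀ i, MemLp (fun x => fderiv ℝ η₁ x (stdOrthonormalBasis ℝ _ i)) 2 volume)
    (h1₂ : ∀ i, MemLp (fun x => fderiv ℝ η₂ x (stdOrthonormalBasis ℝ _ i)) 2 volume)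
    (h2₁ : ∀ i, MemLp (fun x => fderiv ℝ (fun y => fderiv ℝ η₁ y (stdOrthonormalBasis ℝ _ i)) x
      (stdOrthonormalBasis ℝ _ i)) 2 volume)
    (h2₂ : ∀ i, MemLp (fun x => fderiv ℝ (fun y => fderiv ℝ η₂ y (stdOrthonormalBasis ℝ _ i)) x
      (stdOrthonormalBasis ℝ _ i)) 2 volume)
    (hw0₁ : ∀ i, MemLp (fun x => ⟪stdOrthonormalBasis ℝ _ i, x⟫ • η₁ x) 2 volume)
    (hw0₂ : ∀ i, MemLp (fun x => ⟪stdOrthonormalBasis ℝ _ i, x⟫ • η₂ x) 2 volume)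
    (hw1₁ : ∀ i, MemLp (fun x => ⟪stdOrthonormalBasis ℝ _ i, x⟫ •
      fderiv ℝ η₁ x (stdOrthonormalBasis ℝ _ i)) 2 volume)
    (hw1₂ : ∀ i, MemLp (fun x => ⟪stdOrthonormalBasis ℝ _ i, x⟫ •
      fderiv ℝ η₂ x (stdOrthonormalBasis ℝ _ i)) 2 volume)
    (hne : ∃ ξ₀, η₁ ξ₀ ≠ 0) :
    a ≤ M - 1 / 4 := by
  -- `Ū` and `DŪ` are bounded
  obtain ⟨M₀, hM₀⟩ := hUs.continuous.bounded_above_of_compact_support hUc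
  obtain ⟨M₁, hM₁⟩ := (hUs.continuous_fderiv (by simp)).bounded_above_of_compact_support
    (hUc.fderiv (𝕜 := ℝ))
  -- the compactly supported smooth fields `B(Ū, ηⱼ)` and the pressures `qⱼ = −π[B(Ū, ηⱼ)]`
  have hB₁ : ContDiff ℝ ∞ (symConvect Ubar η₁) := contDiff_symConvect hUs hη₁
  have hB₂ : ContDiff ℝ ∞ (symConvect Ubar η₂) := contDiff_symConvect hUs hη₂
  have hB₁c : HasCompactSupport (symConvect Ubar η₁) := hasCompactSupport_symConvect hUc η₁
  have hB₂c : HasCompactSupport (symConvect Ubar η₂) := hasCompactSupport_symConvect hUc η₂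
  have hq₁ : ContDiff ℝ ∞ fun ξ => -divPotential (symConvect Ubar η₁) ξ :=
    (contDiff_divPotential hB₁ hB₁c).neg
  have hq₂ : ContDiff ℝ ∞ fun ξ => -divPotential (symConvect Ubar η₂) ξ :=
    (contDiff_divPotential hB₂ hB₂c).neg
  have hp0₁ : MemLp (fun ξ => -divPotential (symConvect Ubar η₁) ξ) 2 volume :=
    (memLp_divPotential hB₁ hB₁c).neg
  have hp0₂ : MemLp (fun ξ => -divPotential (symConvect Ubar η₂) ξ) 2 volume :=
    (memLp_divPotential hB₂ hB₂c).neg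
  have hDneg : ∀ (G : EuclideanSpace ℝ (Fin 3) → EuclideanSpace ℝ (Fin 3)) (x v : EuclideanSpace ℝ (Fin 3)),
      fderiv ℝ (fun ξ => -divPotential G ξ) x v = -fderiv ℝ (divPotential G) x v := fun G x v => by
    rw [fderiv_fun_neg]
    rfl
  have hp1₁ : ∀ i, MemLp (fun x => fderiv ℝ (fun ξ => -divPotential (symConvect Ubar η₁) ξ) x
      (stdOrthonormalBasis ℝ _ i)) 2 volume := fun i => by
    simp_rw [hDneg]
    exact (memLp_fderiv_divPotential_apply hB₁ hB₁c _).neg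
  have hp1₂ : ∀ i, MemLp (fun x => fderiv ℝ (fun ξ => -divPotential (symConvect Ubar η₂) ξ) x
      (stdOrthonormalBasis ℝ _ i)) 2 volume := fun i => by
    simp_rw [hDneg]
    exact (memLp_fderiv_divPotential_apply hB₂ hB₂c _).neg
  -- the equations in the pressure form `aη₁ − bη₂ + N(η₁) + ∇q₁ = 0`
  have heig₁' : ∀ ξ, a • η₁ ξ - b • η₂ ξ + steadyLinearizedResidual Ubar η₁ ξ +
      gradient (fun ξ => -divPotential (symConvect Ubar η₁) ξ) ξ = 0 := fun ξ => by
    rw [gradient_fun_neg', ← sub_eq_add_neg, add_sub_assoc, ← negLss_eq_steadyLinearizedResidual_sub]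
    exact heig₁ ξ
  have heig₂' : ∀ ξ, b • η₁ ξ + a • η₂ ξ + steadyLinearizedResidual Ubar η₂ ξ +
      gradient (fun ξ => -divPotential (symConvect Ubar η₂) ξ) ξ = 0 := fun ξ => by
    rw [gradient_fun_neg', ← sub_eq_add_neg, add_sub_assoc, ← negLss_eq_steadyLinearizedResidual_sub]
    exact heig₂ ξ
  exact re_eigenvalue_le_of_unstableMode_fin3 hUs hUdiv hM₀ hM₁ hM hη₁ hη₂ hq₁ hq₂ hdiv₁ hdiv₂ heig₁'
    heig₂' h0₁ h0₂ h1₁ h1₂ h2₁ h2₂ hw0₁ hw0₂ hw1₁ hw1₂ hp0₁ hp0₂ hp1₁ hp1₂ hne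

end Verbatim

end AlbrittonBrueColombo2022

end Literature.Analysis.FluidPDE
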